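import Summits.ValiantsHypothesis.ValiantsHypothesis.Theorems.GrenetZeonDualUnipotentThreeHalvesLongMassHomogenise
import Summits.ValiantsHypothesis.ValiantsHypothesis.Theorems.GrenetZeonDualUnipotentThreeHalvesLongMassLedgerIndexShadowSpace

/-!
# `GrenetZeon.DualUnipotentThreeHalves` (stmt-ValiantsHypothesis-24318), line `slow_core`, stub (c) `SlowCore.LongMassSlowLawInv`:
# THE (c)-PRICE IS MONOTONE IN THE VALUE SPACE — sub-value-spaces are cheaper

Sequel of ✓ `…LongMassValueSpace` (`relCert_iff_of_valueSpace_eq`: equal value spaces ⇒ equal prices; this file is independent of it and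
imports only ✓ `…LongMassHomogenise` + ✓ `…LongMassLedgerIndexShadowSpace`).  Here the ONE-SIDED form, which is strictly stronger: ★★★ `relCert_of_valueSpace_le` — if the value space of the linear pencil `N` is CONTAINED in that of the linear pencil `N₁`
(`∀ v ∃ v₁, linMat N v = linMat N₁ v₁`; same `n²` coordinates, parametrisations unrelated), then EVERY certificate price of `N₁` is a certificate
price of `N`: `RelCert n b N₁ P → RelCert n b N P`, with NO loss in the price.

So the (c)-price is a monotone invariant of the nilpotent matrix subspace `W̄ ≤ M_b(ℂ)` (at fixed window parameter `n`): passing to a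
sub-space of directions (deleting, merging or specialising coordinates) never makes a pencil more expensive, and a (c)-violator family stays a
violator under every enlargement of its value spaces.  (The equality version is the two-sided corollary `relCert_iff_of_valueSpace_eq`.)

Proof.  `T, T₁` the linear maps `v ↦ lin v` (✓ `LedgerIndex.exists_linearMap_linMat`), `range T ≤ range T₁`.  Given a certificate `(K₁, k)`
of `N₁` put `K := T⁻¹(T₁K₁)`; the LEDGER transfers because the line of a linear pencil is `lin x + s·lin v` (inlined; cf. ✓
`map_lineSubst_eq_of_linMat_eq`).  PRICE
(`codim_comap_map_le_of_range_le`): `dim K = dim (T₁K₁ ⊓ range T) + dim ker T` (rank–nullity for `T ∘ K.subtype`, `ker T ≤ K`),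
`dim (T₁K₁ ⊓ range T) ≥ dim T₁K₁ + dim range T − dim range T₁` (`T₁K₁ ⊔ range T ≤ range T₁`), `dim T₁K₁ ≥ dim range T₁ − codim K₁`
(✓ `LedgerIndex.codim_map_le_codim`), `dim ker T = n² − dim range T`; summing, `dim K ≥ dim K₁`.

Honest framing.  An invariance / monotonicity lemma (`--supports stmt-ValiantsHypothesis-24318`), NOT progress on (c): (c)
`SlowCore.LongMassSlowLawInv`, S3, the crux 24318, 8062 and `VP ≠ VNP` remain OPEN / NOT proved.  No sorry, no definitions, no named facts.
-/

-- single-conjunct layout: Sub = Summit, duplicated namespace component intended (the name is mandated)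
set_option linter.dupNamespace false
set_option autoImplicit false

noncomputable section

namespace Summit.ValiantsHypothesis.ValiantsHypothesis.Theorems.GrenetZeon.LongMassHomogenise

open MvPolynomial Matrix
open scoped BigOperators
open Summit.ValiantsHypothesis.ValiantsHypothesis.Cruxes.TwoDimCoefficients.DimTwoCases (AffMat IsAffine)
open Summit.ValiantsHypothesis.ValiantsHypothesis.Theorems.GrenetZeon.RadicalSplit (lineSubst)
open Summit.ValiantsHypothesis.ValiantsHypothesis.Theorems.GrenetZeon.SlowCore
open Summit.ValiantsHypothesis.ValiantsHypothesis.Theorems.GrenetZeon.ResolventFlag (linMat)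
open Summit.ValiantsHypothesis.ValiantsHypothesis.Theorems.GrenetZeon.LedgerIndex (exists_linearMap_linMat codim_map_le_codim)

variable {n b : ℕ}

/-- If `range T ≤ range T₁` then `codim T⁻¹(T₁ K₁) ≤ codim K₁` (no loss). -/
theorem codim_comap_map_le_of_range_le (T T₁ : (Fin n × Fin n → ℂ) →ₗ[ℂ] Matrix (Fin b) (Fin b) ℂ)
    (hrange : LinearMap.range T ≤ LinearMap.range T₁) (K₁ : Submodule ℂ (Fin n × Fin n → ℂ)) :
    n * n - Module.finrank ℂ ((K₁.map T₁).comap T) ≤ n * n - Module.finrank ℂ K₁ := by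
  set W := K₁.map T₁ with hW
  set K := W.comap T with hK
  have hV : Module.finrank ℂ (Fin n × Fin n → ℂ) = n * n := by
    rw [Module.finrank_pi, Fintype.card_prod, Fintype.card_fin]
  -- `T K = W ⊓ range T`
  have hmap : K.map T = LinearMap.range T ⊓ W := by rw [hK, Submodule.map_comap_eq]
  -- rank–nullity for `T ∘ K.subtype`
  have h2 := LinearMap.finrank_range_add_finrank_ker (T ∘ₗ K.subtype)
  have hrangeK : LinearMap.range (T ∘ₗ K.subtype) = K.map T := by
    rw [LinearMap.range_comp, Submodule.range_subtype]
  have hkerle : LinearMap.ker T ≤ K := by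
    intro z hz
    rw [hK, Submodule.mem_comap, LinearMap.mem_ker.mp hz]
    exact W.zero_mem
  have hkerK : Module.finrank ℂ (LinearMap.ker (T ∘ₗ K.subtype)) = Module.finrank ℂ (LinearMap.ker T) := by
    rw [LinearMap.ker_comp]
    exact (Submodule.comapSubtypeEquivOfLe hkerle).finrank_eq
  rw [hrangeK, hmap, hkerK, Module.finrank_eq_card_basis (Module.finBasis ℂ K), Fintype.card_fin] at h2
  -- the intersection `range T ⊓ W` against the sum `range T ⊔ W ≤ range T₁`
  have hsum := Submodule.finrank_sup_add_finrank_inf_eq (LinearMap.range T) W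
  have hsuple : LinearMap.range T ⊔ W ≤ LinearMap.range T₁ :=
    sup_le hrange (by rw [hW]; exact LinearMap.map_le_range)
  have hsup : Module.finrank ℂ ↥(LinearMap.range T ⊔ W) ≤ Module.finrank ℂ (LinearMap.range T₁) := Submodule.finrank_mono hsuple
  -- rank–nullity for `T`, the shadow inequality for `T₁`
  have h1 := LinearMap.finrank_range_add_finrank_ker T
  rw [hV] at h1
  have h3 := codim_map_le_codim T₁ K₁
  rw [← hW] at h3
  have hK₁ : Module.finrank ℂ K₁ ≤ n * n := hV ▸ Submodule.finrank_le K₁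
  have hT₁ : Module.finrank ℂ (LinearMap.range T₁) ≤ n * n := by
    have := LinearMap.finrank_range_add_finrank_ker T₁
    rw [hV] at this
    omega
  have hWr : Module.finrank ℂ W ≤ Module.finrank ℂ (LinearMap.range T₁) :=
    Submodule.finrank_mono (by rw [hW]; exact LinearMap.map_le_range)
  omega

/-- ★★★ **THE (c)-PRICE IS MONOTONE IN THE VALUE SPACE.**  If the value space of the linear pencil `N` is contained in that of the linear pencil
`N₁` (same `n²` coordinates), then every certificate price of `N₁` is a certificate price of `N`. -/
theorem relCert_of_valueSpace_le (N N₁ : AffMat n b) (hN : IsAffine N) (hN₁ : IsAffine N₁)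
    (h0 : ∀ i j, coeff 0 (N i j) = 0) (h0₁ : ∀ i j, coeff 0 (N₁ i j) = 0)
    (hle : ∀ v, ∃ v₁, linMat N v = linMat N₁ v₁)
    {P : ℕ} (h : RelCert n b N₁ P) : RelCert n b N P := by
  obtain ⟨T, hT⟩ := exists_linearMap_linMat N
  obtain ⟨T₁, hT₁⟩ := exists_linearMap_linMat N₁
  have hrange : LinearMap.range T ≤ LinearMap.range T₁ := by
    rintro _ ⟨v, rfl⟩
    obtain ⟨v₁, hv₁⟩ := hle v
    exact ⟨v₁, by rw [hT₁, ← hv₁, hT]⟩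
  obtain ⟨K₁, k, hK₁, hprice⟩ := h
  refine ⟨(K₁.map T₁).comap T, k, ?_, ?_⟩
  · intro x v hv p hp i j _ _
    obtain ⟨x₁, hx₁⟩ := hle x
    obtain ⟨v₁, hv₁K, hv₁⟩ := Submodule.mem_map.mp (Submodule.mem_comap.mp hv)
    have hv' : linMat N v = linMat N₁ v₁ := by rw [← hT, ← hT₁, hv₁]
    -- the line of a LINEAR pencil is `lin x + s · lin v`
    have hline : N.map (lineSubst x v) = N₁.map (lineSubst x₁ v₁) := by
      ext i' j' : 2
      simp only [Matrix.map_apply]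
      have hx'' : linEntry N i' j' x = linEntry N₁ i' j' x₁ := by
        have := congr_fun (congr_fun hx₁ i') j'
        simpa [linMat] using this
      have hv'' : linEntry N i' j' v = linEntry N₁ i' j' v₁ := by
        have := congr_fun (congr_fun hv' i') j'
        simpa [linMat] using this
      have he : eval x (N i' j') = linEntry N i' j' x := by
        rw [eval_eq_of_totalDegree_le_one _ (hN i' j'), h0, zero_add, linEntry]
        exact Finset.sum_congr rfl fun e _ => mul_comm _ _
      have he₁ : eval x₁ (N₁ i' j') = linEntry N₁ i' j' x₁ := by
        rw [eval_eq_of_totalDegree_le_one _ (hN₁ i' j'), h0₁, zero_add, linEntry]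
        exact Finset.sum_congr rfl fun e _ => mul_comm _ _
      rw [lineSubst_apply_of_le_one N hN, lineSubst_apply_of_le_one N₁ hN₁, he, he₁, hx'', hv'']
    rw [hline]
    exact hK₁ x₁ v₁ hv₁K p hp i j trivial trivial
  · exact le_trans (Nat.add_le_add_left (codim_comap_map_le_of_range_le T T₁ hrange K₁) _) hprice

end Summit.ValiantsHypothesis.ValiantsHypothesis.Theorems.GrenetZeon.LongMassHomogenise

end
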